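import Summits.HodgeConjecture.HodgeConjecture.Theorems.SignSymmetricPowersLinkConjugacy
import Summits.HodgeConjecture.HodgeConjecture.Theorems.SignSymmetricPowersGenPairCentreSign
import HarnessLib

/-!
# K1-B piece LINK-G, part (C): pencil circles around two pair-type members have `Γ`-conjugate transports
# (route `SignSymmetricPowers`, item stmt-HodgeConjecture-19716)

Line `andre-zariski`, skeleton v12f (`276eda50fce4ca90`); helper file for the registered stub
`stub_signConfluenceLinkG` (LINK-G), landed `--supports stmt-HodgeConjecture-19716`.  Companion of
`SignSymmetricPowersLinkConjugacy` (the one-node case).  Setting as there: `π_M : 𝒴_M → S_M` the family of smooth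
`M`-supported hypersurfaces, `D_M = w · ∏ⱼ hⱼ^{eⱼ}` the restricted discriminant written through irreducible `hⱼ`,
F-MC (`affineHypersurfaceComplement_meridian_isConj`) and F-DISC-1 (`discriminant_localBranches_nodal`) granted.

* §1 **`exists_conj_transport_of_meridianFields`** (any `n, d, M`) — the generic F-MC consumer: two pencil circles
  whose centres lie on the SAME listed hypersurface `V(h_{j₀})` only, transversally (the three `Meridian` fields at
  each centre), moved to the base point `t`, have `Γ_t`-conjugate transports (packages IV, III, `MonoidHom.map_isConj`
  along the inverse chart).
* §2 the sign family (`n = 3`, `M` = ι-even monomials, `γ = (−1,−1,1,1,1)`): `free_of_isNodalFormWithNodes_pair`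
  (an exchanged pair of nodes `q, γ•q` is free: `(q₀,q₁) ≠ 0 ≠ (q₂,q₃,q₄)`), **`exists_unique_factor_freePair`**
  (`SignSymmetricPowersGenPairCentre.exists_unique_factor_pair` with the separating form `ℓ^d`,
  `ℓ = x_{i₀}/q_{i₀} + x_{i₁}/q_{i₁}`, and the chart monomial `x_{i₁}^d` supplied).
* §3 **`exists_conj_transport_of_pairs`** — for the pair-type member `f₃` (nodes `(±1:0:1:0:0)`) and ANY pair-type
  member `F₂` (nodes `q, γ•q`) lying on a COMMON listed hypersurface (hypothesis `hsame`, the "same component"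
  input — supplied by the irreducibility of the free stratum of the discriminant), the transports of the two
  pencil circles are `Γ_t`-conjugate.

Sorry-free; axioms `propext`, `Classical.choice`, `Quot.sound`; no definition, no named fact.

## References

* [Shimada2010ZvK] I. Shimada, Lectures on Zariski–van Kampen theorem (arXiv:0906.1074), §3 Prop. 3.4.
* [Deligne1974] P. Deligne, La conjecture de Weil. I, Publ. Math. IHÉS 43 (1974), proof of Thm. (5.4), p. 291.
* [VoisinHodgeII2003] C. Voisin, Hodge Theory and Complex Algebraic Geometry II (CUP 2003), §2.1.1, §2.3.1, §3.1.2,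
  §3.2.2, §6.2.1.
-/

noncomputable section

set_option linter.dupNamespace false

open CategoryTheory MvPolynomial Topology
open Literature.AlgebraicTopology.SingularHomology
open Literature.AlgebraicGeometry.Motives Literature.AlgebraicGeometry.Motives.UniversalHypersurface
open Literature.AlgebraicGeometry.HodgeTheory Literature.AlgebraicGeometry.HodgeTheory.UniversalHypersurface
open Literature.AlgebraicGeometry.FundamentalGroup
open Summit.HodgeConjecture.HodgeConjecture.Theorems.SignSymmetricPowersMeridianPencil
open Summit.HodgeConjecture.HodgeConjecture.Theorems.SignSymmetricPowersMeridianMonodromy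
open Summit.HodgeConjecture.HodgeConjecture.Theorems.SignSymmetricPowersLinkConjugacy
open Summit.HodgeConjecture.HodgeConjecture.Theorems.SignSymmetricPowersGenPairCentre
open Summit.HodgeConjecture.HodgeConjecture.Theorems.SignSymmetricPowersGenDiagonalCoeff

namespace Summit.HodgeConjecture.HodgeConjecture.Theorems.SignSymmetricPowersLinkPairConjugacy

/-! ### §1 The generic consumer of F-MC -/

section Generic

variable (n d : ℕ) (M : Set (DegIndex n d)) [DecidablePred (· ∈ M)]

/-- **Pencil circles around two members on the same listed component have `Γ`-conjugate transports.**  Let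
`D_M = w · ∏ⱼ hⱼ^{eⱼ}` (`w` a unit, `hⱼ` irreducible, `eⱼ ≥ 1`), F-MC granted, and let `f₁, g` and `f₁', g'` be
`M`-supported degree-`d` forms such that `coeff_M f₁` and `coeff_M f₁'` lie on `V(h_{j₀})` and on no other `V(hᵢ)`,
with the directions `coeff_M g`, `coeff_M g'` transversal to `V(h_{j₀})` there; let the punctured closed pencil discs
of radii `ε, ε'` be nonsingular, `β : t ⇝ s`, `β' : t ⇝ s'` paths to the points of `f₁ + ε g`, `f₁' + ε' g'`, and
`ω, ω'` the pencil circles there.  Then the rational transports `T, T'` of `π_M` along `β·ω·β⁻¹`, `β'·ω'·β'⁻¹` satisfy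
`T' = γ T γ⁻¹` for some `γ ∈ Γ_t`. [cite: Shimada2010ZvK, §3 Prop. 3.4] [cite: Deligne1974, proof of Thm. (5.4), p. 291]
[cite: VoisinHodgeII2003, §3.1.2 and §3.2.2] -/
theorem exists_conj_transport_of_meridianFields (hMC : affineHypersurfaceComplement_meridian_isConj)
    {Disc : MvPolynomial (DegIndex n d) ℂ}
    (hV : ∀ a : DegIndex n d → ℂ, a ∈ singularCoeffs n d ↔ MvPolynomial.eval a Disc = 0) (hn : 1 ≤ n) (hd : 1 ≤ d)
    {m : ℕ} {w : MvPolynomial M ℂ} (hw : IsUnit w) {h : Fin m → MvPolynomial M ℂ} (hirrh : ∀ j, Irreducible (h j))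
    {e : Fin m → ℕ} (he : ∀ j, 1 ≤ e j) (hfac : killHom ℂ n d M Disc = w * ∏ j, h j ^ e j)
    (hU : IsCohomologicallyLocallyTrivialOn (familyM ℂ n d M) Set.univ)
    {f₁ g f₁' g' : MvPolynomial (Fin (n + 2)) ℂ} (hf₁ : f₁.IsHomogeneous d) (hg : g.IsHomogeneous d)
    (hf₁' : f₁'.IsHomogeneous d) (hg' : g'.IsHomogeneous d)
    (hM₁ : IsSupportedOn n d M f₁) (hMg : IsSupportedOn n d M g)
    (hM₁' : IsSupportedOn n d M f₁') (hMg' : IsSupportedOn n d M g') {j₀ : Fin m}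
    (h0 : MvPolynomial.eval (fun m' : M => coeff m'.1.1 f₁) (h j₀) = 0)
    (hne : ∀ i, i ≠ j₀ → MvPolynomial.eval (fun m' : M => coeff m'.1.1 f₁) (h i) ≠ 0)
    (htr : haveI : Fintype M := Subtype.fintype _
      ∑ k, MvPolynomial.eval (fun m' : M => coeff m'.1.1 f₁) (pderiv k (h j₀)) * (fun m' : M => coeff m'.1.1 g) k ≠ 0)
    (h0' : MvPolynomial.eval (fun m' : M => coeff m'.1.1 f₁') (h j₀) = 0)
    (hne' : ∀ i, i ≠ j₀ → MvPolynomial.eval (fun m' : M => coeff m'.1.1 f₁') (h i) ≠ 0)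
    (htr' : haveI : Fintype M := Subtype.fintype _
      ∑ k, MvPolynomial.eval (fun m' : M => coeff m'.1.1 f₁') (pderiv k (h j₀)) * (fun m' : M => coeff m'.1.1 g') k ≠ 0)
    {ε ε' : ℝ} (hε : 0 < ε) (hε' : 0 < ε')
    (hns : ∀ c : ℂ, c ≠ 0 → ‖c‖ ≤ ε → SmoothHypersurface.IsNonsingularForm ℂ (f₁ + c • g))
    (hns' : ∀ c : ℂ, c ≠ 0 → ‖c‖ ≤ ε' → SmoothHypersurface.IsNonsingularForm ℂ (f₁' + c • g'))
    {t s s' : ComplexPoints (baseM ℂ n d M)}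
    (β : Path t s) (hs : pointFormM ℂ n d M s = f₁ + ((ε : ℝ) : ℂ) • g) (ω : Path s s)
    (hω : IsPencilCircle n d f₁ g ε (ω.map (AlgPoints.mapContinuous (toBase ℂ n d M)).continuous))
    (β' : Path t s') (hs' : pointFormM ℂ n d M s' = f₁' + ((ε' : ℝ) : ℂ) • g') (ω' : Path s' s')
    (hω' : IsPencilCircle n d f₁' g' ε' (ω'.map (AlgPoints.mapContinuous (toBase ℂ n d M)).continuous))
    {k : ℕ}
    {T T' : bettiCohomology (fiberOver (familyM ℂ n d M) t) k ≃ₗ[ℚ] bettiCohomology (fiberOver (familyM ℂ n d M) t) k}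
    (hT : IsRatTransport (familyM ℂ n d M) k hU ⟦((β.trans ω).trans β.symm).map
      (⟨fun s => ⟨s, Set.mem_univ s⟩, continuous_id.subtype_mk _⟩ :
        C(ComplexPoints (baseM ℂ n d M), (Set.univ : Set (ComplexPoints (baseM ℂ n d M))))).continuous⟧ T)
    (hT' : IsRatTransport (familyM ℂ n d M) k hU ⟦((β'.trans ω').trans β'.symm).map
      (⟨fun s => ⟨s, Set.mem_univ s⟩, continuous_id.subtype_mk _⟩ :
        C(ComplexPoints (baseM ℂ n d M), (Set.univ : Set (ComplexPoints (baseM ℂ n d M))))).continuous⟧ T') :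
    ∃ γ ∈ ratMonodromyGroup (familyM ℂ n d M) k hU ⟨t, Set.mem_univ t⟩, T' = γ * T * γ⁻¹ := by
  classical
  obtain ⟨eH, heH⟩ := exists_homeomorph_of_complement_eq n d M hV h (eval_ne_zero_iff_of_factorization hw he hfac)
  obtain ⟨μ, -, -, -, hμ⟩ := exists_meridian_of_pencilCircle n d M eH heH hf₁ hg hM₁ hMg h0 hne htr hε hns β hs ω hω
  obtain ⟨μ', -, -, -, hμ'⟩ :=
    exists_meridian_of_pencilCircle n d M eH heH hf₁' hg' hM₁' hMg' h0' hne' htr' hε' hns' β' hs' ω' hω'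
  have hconj : IsConj μ.loopClass μ'.loopClass := hMC M m h hirrh (eH t) j₀ μ μ'
  have hconj' := (FundamentalGroup.mapOfEq
    (⟨fun z => ⟨eH.symm z, Set.mem_univ _⟩, (continuous_id.subtype_mk _).comp eH.symm.continuous⟩ :
      C(affineHypersurfaceComplement h, (Set.univ : Set (ComplexPoints (baseM ℂ n d M)))))
    (show (⟨eH.symm (eH t), Set.mem_univ _⟩ : (Set.univ : Set (ComplexPoints (baseM ℂ n d M)))) =
      ⟨t, Set.mem_univ t⟩ from Subtype.ext (eH.symm_apply_apply t))).map_isConj hconj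
  have hc : IsConj
      (FundamentalGroup.fromPath (Path.Homotopic.Quotient.mk (((β.trans ω).trans β.symm).map
        (⟨fun s => ⟨s, Set.mem_univ s⟩, continuous_id.subtype_mk _⟩ :
          C(ComplexPoints (baseM ℂ n d M), (Set.univ : Set (ComplexPoints (baseM ℂ n d M))))).continuous)))
      (FundamentalGroup.fromPath (Path.Homotopic.Quotient.mk (((β'.trans ω').trans β'.symm).map
        (⟨fun s => ⟨s, Set.mem_univ s⟩, continuous_id.subtype_mk _⟩ :
          C(ComplexPoints (baseM ℂ n d M), (Set.univ : Set (ComplexPoints (baseM ℂ n d M))))).continuous))) := by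
    convert hconj' using 1
    · exact hμ.symm
    · exact hμ'.symm
  exact exists_conj_of_isConj (familyM ℂ n d M) k hU
    (fun _ _ δ' _ hα => isRationalClass_transportFun_familyM n d M hn hd k hU δ' hα) ⟨t, Set.mem_univ t⟩ hc hT hT'

end Generic

/-! ### §2 The sign family: exchanged pairs of nodes are free; the pair centre at a free pair -/

section Sign

/-- In the sign family (`γ = (−1,−1,1,1,1)`), an exchanged pair of nodes `q, γ • q` consists of FREE points:
`(q₀, q₁) ≠ 0` (else `γ • q = q`) and `(q₂, q₃, q₄) ≠ 0` (else `γ • q = −q`), as the two nodes are distinct points of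
`ℙ⁴`. [cite: VoisinHodgeII2003, §2.3.1] -/
theorem free_of_isNodalFormWithNodes_pair {F : MvPolynomial (Fin 5) ℂ} {q : Fin 5 → ℂ}
    (hnod : IsNodalFormWithNodes F
      ![q, fun i => ((fun i : Fin 5 => if (i : ℕ) < 2 then (-1 : ℂˣ) else 1) i : ℂ) * q i]) :
    (∃ i₀ : Fin 5, (i₀ : ℕ) < 2 ∧ q i₀ ≠ 0) ∧ (∃ i₁ : Fin 5, ¬ (i₁ : ℕ) < 2 ∧ q i₁ ≠ 0) := by
  obtain ⟨-, hdist, -⟩ := hnod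
  constructor
  · by_contra hall
    push Not at hall
    have h0 : q 0 = 0 := hall 0 (by decide)
    have h1 : q 1 = 0 := hall 1 (by decide)
    have h01 := hdist 0 1 ⟨1, by
      funext i
      fin_cases i <;> simp [h0, h1]⟩
    exact absurd h01 (by decide)
  · by_contra hall
    push Not at hall
    have h2 : q 2 = 0 := hall 2 (by decide)
    have h3 : q 3 = 0 := hall 3 (by decide)
    have h4 : q 4 = 0 := hall 4 (by decide)
    have h01 := hdist 0 1 ⟨-1, by
      funext i
      fin_cases i <;> simp [h2, h3, h4]⟩
    exact absurd h01 (by decide)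

/-- **Pair centre at a free exchanged pair (sign family).**  `SignSymmetricPowersGenPairCentre.exists_unique_factor_pair`
for `n = 3`, the ι-even monomials `M`, `γ = (−1,−1,1,1,1)` and ANY `M`-supported degree-`d` form `F` whose singular points
are exactly an exchanged pair of nodes `q, γ • q`, with the separating form `(x_{i₀}/q_{i₀} + x_{i₁}/q_{i₁})^d`
(`i₀ < 2 ≤ i₁`, `q_{i₀}, q_{i₁} ≠ 0` by freeness) and the chart monomial `x_{i₁}^d`: for
`D_M = w · ∏ⱼ hⱼ^{eⱼ}` (unit `w`, pairwise non-associated irreducible `hⱼ`, `eⱼ ≥ 1`), GRANTED F-DISC-1, exactly one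
`h_{j₀}` vanishes at `coeff_M F`, `e_{j₀} = 2`, and every `M`-supported direction `G` with `G(q), G(γ•q) ≠ 0` is
transversal. [cite: VoisinHodgeII2003, §2.1.1 Lemma 2.7, Cor. 2.8] -/
theorem exists_unique_factor_freePair (hB : discriminant_localBranches_nodal) {d : ℕ} (hd : 1 ≤ d)
    {Disc : MvPolynomial (DegIndex 3 d) ℂ} (hirr : Irreducible Disc)
    (hV : ∀ a : DegIndex 3 d → ℂ, a ∈ singularCoeffs 3 d ↔ MvPolynomial.eval a Disc = 0)
    (hγ : FixesMonomials ℂ 3 d {m : DegIndex 3 d | Even (m.1 0 + m.1 1)}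
      (fun i : Fin 5 => if (i : ℕ) < 2 then -1 else 1))
    {m : ℕ} (w : MvPolynomial {m : DegIndex 3 d | Even (m.1 0 + m.1 1)} ℂ) (hw : IsUnit w)
    (h : Fin m → MvPolynomial {m : DegIndex 3 d | Even (m.1 0 + m.1 1)} ℂ) (e : Fin m → ℕ)
    (hirrh : ∀ j, Irreducible (h j)) (hna : ∀ i j, i ≠ j → ¬ Associated (h i) (h j)) (he : ∀ j, 1 ≤ e j)
    (hfac : killHom ℂ 3 d {m : DegIndex 3 d | Even (m.1 0 + m.1 1)} Disc = w * ∏ j, h j ^ e j)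
    {F : MvPolynomial (Fin 5) ℂ} (hF : F.IsHomogeneous d)
    (hMF : IsSupportedOn 3 d {m : DegIndex 3 d | Even (m.1 0 + m.1 1)} F) {q : Fin 5 → ℂ}
    (hnod : IsNodalFormWithNodes F
      ![q, fun i => ((fun i : Fin 5 => if (i : ℕ) < 2 then (-1 : ℂˣ) else 1) i : ℂ) * q i])
    {G : MvPolynomial (Fin 5) ℂ} (hG : G.IsHomogeneous d)
    (hMG : IsSupportedOn 3 d {m : DegIndex 3 d | Even (m.1 0 + m.1 1)} G)
    (hGq : MvPolynomial.eval q G ≠ 0)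
    (hGq' : MvPolynomial.eval (fun i => ((fun i : Fin 5 => if (i : ℕ) < 2 then (-1 : ℂˣ) else 1) i : ℂ) * q i) G ≠ 0) :
    haveI : Fintype {m : DegIndex 3 d | Even (m.1 0 + m.1 1)} := Subtype.fintype _
    ∃ j₀, MvPolynomial.eval (fun m' : {m : DegIndex 3 d | Even (m.1 0 + m.1 1)} => coeff m'.1.1 F) (h j₀) = 0 ∧
      e j₀ = 2 ∧
      (∀ i, i ≠ j₀ →
        MvPolynomial.eval (fun m' : {m : DegIndex 3 d | Even (m.1 0 + m.1 1)} => coeff m'.1.1 F) (h i) ≠ 0) ∧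
      ∑ k, MvPolynomial.eval (fun m' : {m : DegIndex 3 d | Even (m.1 0 + m.1 1)} => coeff m'.1.1 F)
          (pderiv k (h j₀)) * (fun m' : {m : DegIndex 3 d | Even (m.1 0 + m.1 1)} => coeff m'.1.1 G) k ≠ 0 := by
  classical
  set γ : Fin 5 → ℂˣ := fun i : Fin 5 => if (i : ℕ) < 2 then -1 else 1 with hγdef
  obtain ⟨⟨i₀, hi₀, hq₀⟩, ⟨i₁, hi₁, hq₁⟩⟩ := free_of_isNodalFormWithNodes_pair hnod
  have hγ₀ : (γ i₀ : ℂ) = -1 := by simp only [hγdef, if_pos hi₀, Units.val_neg, Units.val_one]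
  have hγ₁ : (γ i₁ : ℂ) = 1 := by simp only [hγdef, if_neg hi₁, Units.val_one]
  -- the exchanged nodes
  have hq' : (fun i => (γ i : ℂ) * q i) = fun i => (γ i : ℂ) * q i := rfl
  have hq : (fun i => (γ i : ℂ) * ((fun i => (γ i : ℂ) * q i) i)) = q := by
    funext i; fin_cases i <;> simp [hγdef]
  -- the separating form `ℓ^d`, `ℓ = x_{i₀}/q_{i₀} + x_{i₁}/q_{i₁}`
  set ℓ : MvPolynomial (Fin 5) ℂ := C (q i₀)⁻¹ * X i₀ + C (q i₁)⁻¹ * X i₁ with hℓ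
  have hℓh : ℓ.IsHomogeneous 1 := by
    have h1 : ∀ (c : ℂ) (i : Fin 5), (C c * X i : MvPolynomial (Fin 5) ℂ).IsHomogeneous 1 := fun c i => by
      simpa using (isHomogeneous_C (Fin 5) c).mul (isHomogeneous_X ℂ i)
    exact (h1 _ i₀).add (h1 _ i₁)
  have hsep : (ℓ ^ d).IsHomogeneous d := by simpa using hℓh.pow d
  have hℓq : MvPolynomial.eval q ℓ = 2 := by
    simp only [hℓ, map_add, map_mul, eval_C, eval_X, inv_mul_cancel₀ hq₀, inv_mul_cancel₀ hq₁]; norm_num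
  have hℓq' : MvPolynomial.eval (fun i => (γ i : ℂ) * q i) ℓ = 0 := by
    simp only [hℓ, map_add, map_mul, eval_C, eval_X, hγ₀, hγ₁, neg_one_mul, one_mul, mul_neg,
      inv_mul_cancel₀ hq₀, inv_mul_cancel₀ hq₁]; norm_num
  have hsepq : MvPolynomial.eval q (ℓ ^ d) ≠ 0 := by
    rw [map_pow, hℓq]; exact pow_ne_zero d two_ne_zero
  have hsepq' : MvPolynomial.eval (fun i => (γ i : ℂ) * q i) (ℓ ^ d) = 0 := by
    rw [map_pow, hℓq']; exact zero_pow (by omega)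
  -- the chart monomial `x_{i₁}^d ∈ M`
  have hdeg : (Finsupp.single i₁ d).degree = d := by simp
  have hi₁0 : i₁ ≠ 0 := by rintro rfl; exact hi₁ (by decide)
  have hi₁1 : i₁ ≠ 1 := by rintro rfl; exact hi₁ (by decide)
  have hm₀M : (⟨Finsupp.single i₁ d, hdeg⟩ : DegIndex 3 d) ∈ {m : DegIndex 3 d | Even (m.1 0 + m.1 1)} := by
    show Even ((Finsupp.single i₁ d) 0 + (Finsupp.single i₁ d) 1)
    rw [Finsupp.single_eq_of_ne hi₁0.symm, Finsupp.single_eq_of_ne hi₁1.symm]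
    exact ⟨0, rfl⟩
  have hm₀ : MvPolynomial.eval q
      (monomial (⟨⟨Finsupp.single i₁ d, hdeg⟩, hm₀M⟩ : {m : DegIndex 3 d | Even (m.1 0 + m.1 1)}).1.1 (1 : ℂ)) ≠ 0 := by
    simp [eval_monomial, hq₁]
  exact exists_unique_factor_pair 3 d {m : DegIndex 3 d | Even (m.1 0 + m.1 1)} hB hirr hV hγ w hw h e hirrh hna he
    hfac hF hMF hq' hq hnod hsep hsepq hsepq' ⟨⟨Finsupp.single i₁ d, hdeg⟩, hm₀M⟩ hm₀ hG hMG hGq hGq'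


/-! ### §3 Conjugate transports of two pair-type pencil circles -/

/-- **Pencil circles around two pair-type members of the sign family have `Γ`-conjugate transports, given that the
two members lie on a common listed hypersurface.**  Let `f₃` be the `M`-supported pair member with nodes
`(±1:0:1:0:0)` and `g₃` an `M`-supported direction with `g₃(1,0,1,0,0) ≠ 0`; let `F₂` be any `M`-supported form whose
singular points are an exchanged pair of nodes `q, γ•q`, `G₂` an `M`-supported direction non-vanishing at both;
assume `h_j(coeff_M f₃) = h_j(coeff_M F₂) = 0` for SOME listed `h_j` (`hsame`).  Then — F-MC and F-DISC-1 granted,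
`D_M = w·∏ hⱼ^{eⱼ}` with pairwise non-associated irreducible `hⱼ` — for nonsingular punctured closed pencil discs of
radii `ε, ε'`, paths `β, β'` from `t` and pencil circles `ω, ω'`, the transports of `π_M` along `β·ω·β⁻¹` and
`β'·ω'·β'⁻¹` are conjugate in `Γ_t`.  (Uniqueness of the vanishing factor at each pair centre —
`exists_unique_factor_signPair`, `exists_unique_factor_freePair` — turns `hsame` into "same index", and §1 applies.)
[cite: Shimada2010ZvK, §3 Prop. 3.4] [cite: Deligne1974, proof of Thm. (5.4), p. 291] [cite: VoisinHodgeII2003, §3.2.2] -/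
theorem exists_conj_transport_of_pairs (hMC : affineHypersurfaceComplement_meridian_isConj)
    (hB : discriminant_localBranches_nodal) {d : ℕ} (hd : 1 ≤ d)
    {Disc : MvPolynomial (DegIndex 3 d) ℂ} (hirr : Irreducible Disc)
    (hV : ∀ a : DegIndex 3 d → ℂ, a ∈ singularCoeffs 3 d ↔ MvPolynomial.eval a Disc = 0)
    (hγ : FixesMonomials ℂ 3 d {m : DegIndex 3 d | Even (m.1 0 + m.1 1)}
      (fun i : Fin 5 => if (i : ℕ) < 2 then -1 else 1))
    {m : ℕ} {w : MvPolynomial {m : DegIndex 3 d | Even (m.1 0 + m.1 1)} ℂ} (hw : IsUnit w)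
    {h : Fin m → MvPolynomial {m : DegIndex 3 d | Even (m.1 0 + m.1 1)} ℂ} {e : Fin m → ℕ}
    (hirrh : ∀ j, Irreducible (h j)) (hna : ∀ i j, i ≠ j → ¬ Associated (h i) (h j)) (he : ∀ j, 1 ≤ e j)
    (hfac : killHom ℂ 3 d {m : DegIndex 3 d | Even (m.1 0 + m.1 1)} Disc = w * ∏ j, h j ^ e j)
    (hU : IsCohomologicallyLocallyTrivialOn (familyM ℂ 3 d {m : DegIndex 3 d | Even (m.1 0 + m.1 1)}) Set.univ)
    {f₃ g₃ : MvPolynomial (Fin 5) ℂ} (hf₃ : f₃.IsHomogeneous d) (hg₃ : g₃.IsHomogeneous d)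
    (hM₃ : IsSupportedOn 3 d {m : DegIndex 3 d | Even (m.1 0 + m.1 1)} f₃)
    (hMg₃ : IsSupportedOn 3 d {m : DegIndex 3 d | Even (m.1 0 + m.1 1)} g₃)
    (hnod₃ : IsNodalFormWithNodes f₃ ![![1, 0, 1, 0, 0], ![-1, 0, 1, 0, 0]])
    (hg₃q : MvPolynomial.eval ![1, 0, 1, 0, 0] g₃ ≠ 0)
    {F₂ G₂ : MvPolynomial (Fin 5) ℂ} (hF₂ : F₂.IsHomogeneous d) (hG₂ : G₂.IsHomogeneous d)
    (hMF₂ : IsSupportedOn 3 d {m : DegIndex 3 d | Even (m.1 0 + m.1 1)} F₂)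
    (hMG₂ : IsSupportedOn 3 d {m : DegIndex 3 d | Even (m.1 0 + m.1 1)} G₂) {q : Fin 5 → ℂ}
    (hnodF : IsNodalFormWithNodes F₂
      ![q, fun i => ((fun i : Fin 5 => if (i : ℕ) < 2 then (-1 : ℂˣ) else 1) i : ℂ) * q i])
    (hGq : MvPolynomial.eval q G₂ ≠ 0)
    (hGq' : MvPolynomial.eval (fun i => ((fun i : Fin 5 => if (i : ℕ) < 2 then (-1 : ℂˣ) else 1) i : ℂ) * q i) G₂ ≠ 0)
    (hsame : ∃ j, MvPolynomial.eval (fun m' : {m : DegIndex 3 d | Even (m.1 0 + m.1 1)} => coeff m'.1.1 f₃) (h j) = 0 ∧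
      MvPolynomial.eval (fun m' : {m : DegIndex 3 d | Even (m.1 0 + m.1 1)} => coeff m'.1.1 F₂) (h j) = 0)
    {ε ε' : ℝ} (hε : 0 < ε) (hε' : 0 < ε')
    (hns : ∀ c : ℂ, c ≠ 0 → ‖c‖ ≤ ε → SmoothHypersurface.IsNonsingularForm ℂ (f₃ + c • g₃))
    (hns' : ∀ c : ℂ, c ≠ 0 → ‖c‖ ≤ ε' → SmoothHypersurface.IsNonsingularForm ℂ (F₂ + c • G₂))
    {t s s' : ComplexPoints (baseM ℂ 3 d {m : DegIndex 3 d | Even (m.1 0 + m.1 1)})}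
    (β : Path t s) (hs : pointFormM ℂ 3 d {m : DegIndex 3 d | Even (m.1 0 + m.1 1)} s = f₃ + ((ε : ℝ) : ℂ) • g₃)
    (ω : Path s s)
    (hω : IsPencilCircle 3 d f₃ g₃ ε
      (ω.map (AlgPoints.mapContinuous (toBase ℂ 3 d {m : DegIndex 3 d | Even (m.1 0 + m.1 1)})).continuous))
    (β' : Path t s') (hs' : pointFormM ℂ 3 d {m : DegIndex 3 d | Even (m.1 0 + m.1 1)} s' = F₂ + ((ε' : ℝ) : ℂ) • G₂)
    (ω' : Path s' s')
    (hω' : IsPencilCircle 3 d F₂ G₂ ε'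
      (ω'.map (AlgPoints.mapContinuous (toBase ℂ 3 d {m : DegIndex 3 d | Even (m.1 0 + m.1 1)})).continuous))
    {k : ℕ}
    {T T' : bettiCohomology (fiberOver (familyM ℂ 3 d {m : DegIndex 3 d | Even (m.1 0 + m.1 1)}) t) k ≃ₗ[ℚ]
      bettiCohomology (fiberOver (familyM ℂ 3 d {m : DegIndex 3 d | Even (m.1 0 + m.1 1)}) t) k}
    (hT : IsRatTransport (familyM ℂ 3 d {m : DegIndex 3 d | Even (m.1 0 + m.1 1)}) k hU ⟦((β.trans ω).trans β.symm).map
      (⟨fun s => ⟨s, Set.mem_univ s⟩, continuous_id.subtype_mk _⟩ :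
        C(ComplexPoints (baseM ℂ 3 d {m : DegIndex 3 d | Even (m.1 0 + m.1 1)}),
          (Set.univ : Set (ComplexPoints (baseM ℂ 3 d {m : DegIndex 3 d | Even (m.1 0 + m.1 1)}))))).continuous⟧ T)
    (hT' : IsRatTransport (familyM ℂ 3 d {m : DegIndex 3 d | Even (m.1 0 + m.1 1)}) k hU
      ⟦((β'.trans ω').trans β'.symm).map
      (⟨fun s => ⟨s, Set.mem_univ s⟩, continuous_id.subtype_mk _⟩ :
        C(ComplexPoints (baseM ℂ 3 d {m : DegIndex 3 d | Even (m.1 0 + m.1 1)}),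
          (Set.univ : Set (ComplexPoints (baseM ℂ 3 d {m : DegIndex 3 d | Even (m.1 0 + m.1 1)}))))).continuous⟧ T') :
    ∃ γ' ∈ ratMonodromyGroup (familyM ℂ 3 d {m : DegIndex 3 d | Even (m.1 0 + m.1 1)}) k hU ⟨t, Set.mem_univ t⟩,
      T' = γ' * T * γ'⁻¹ := by
  classical
  -- the vanishing factor at each pair centre, and their coincidence
  obtain ⟨j₃, h0₃, -, hne₃, htr₃⟩ := SignSymmetricPowersGenPairCentreSign.exists_unique_factor_signPair hB hd hirr hV hγ
    w hw h e hirrh hna he hfac hf₃ hM₃ hnod₃ hg₃ hMg₃ hg₃q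
  obtain ⟨jF, h0F, -, hneF, htrF⟩ := exists_unique_factor_freePair hB hd hirr hV hγ w hw h e hirrh hna he hfac hF₂ hMF₂
    hnodF hG₂ hMG₂ hGq hGq'
  obtain ⟨j, hj₃, hjF⟩ := hsame
  have e₃ : j = j₃ := by by_contra hne; exact hne₃ j hne hj₃
  have eF : j = jF := by by_contra hne; exact hneF j hne hjF
  subst e₃
  subst eF
  exact exists_conj_transport_of_meridianFields 3 d {m : DegIndex 3 d | Even (m.1 0 + m.1 1)} hMC hV (by omega) hd hw
    hirrh he hfac hU hf₃ hg₃ hF₂ hG₂ hM₃ hMg₃ hMF₂ hMG₂ h0₃ hne₃ htr₃ h0F hneF htrF hε hε' hns hns' β hs ω hω β' hs'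
    ω' hω' hT hT'

end Sign

end Summit.HodgeConjecture.HodgeConjecture.Theorems.SignSymmetricPowersLinkPairConjugacy

end
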